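import Mathlib

/-!
# Hodge-locus census — the HILBERT-FUNCTION COUNT behind transversality (def-free helper of `stmt-HodgeConjecture-16267`)

THEOREM 1 (ii) of the cell record `og81/FERMAT-PAIRS-ALL-DEGREES-g29.md` (pub-hlocus, lead gen 29) uses the Hilbert function
`h_n(t) = [x^t](1 + x + ⋯ + x^{d-2})^n` of `K[y_1,…,y_n]/(y_i^{d-1})` and the identity `h_n(d) = C(n-1+d, d) - n^2` (valid for
`d ≥ 3`), which together with `transversality_arith` of `HodgeLocusCensusGorensteinCore` gives `c_d = c_N` for every pair type.
Here that identity is kernel-checked as a statement about coefficients of integer power series: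
`coeff d ((∑_{j<d-1} X^j)^(m+1)) = C(m+d, d) - (m+1)^2` for `3 ≤ d` (take `n = m + 1`).

certified instances and evidence bearing on the general Hodge conjecture; no claim.
-/

namespace Summit.HodgeConjecture.HodgeConjecture.HodgeLocus.Census.HilbertCount

open PowerSeries

/-- The truncated geometric series as `(1 + X + X² + ⋯)·(1 - X^e)`. -/
theorem geom_trunc_eq (e : ℕ) :
    (∑ j ∈ Finset.range e, (X : ℤ⟦X⟧) ^ j) = PowerSeries.mk 1 - X ^ e * PowerSeries.mk 1 := by
  ext t
  simp only [map_sum, map_sub, coeff_X_pow, coeff_X_pow_mul', coeff_mk, Pi.one_apply, Finset.sum_ite_eq,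
    Finset.mem_range]
  rcases Nat.lt_or_ge t e with h | h
  · rw [if_pos h, if_neg (by omega)]; simp
  · rw [if_neg (by omega), if_pos h]; simp

/-- Second-order expansion of `((1 - X^e)·A)^n`, `A = 1 + X + X² + ⋯`: the terms of `X`-order `≥ 2e` are collected in `R`. -/
theorem pow_expand (e n : ℕ) : ∃ R : ℤ⟦X⟧,
    (PowerSeries.mk 1 - X ^ e * PowerSeries.mk 1) ^ n = (PowerSeries.mk 1) ^ n - C (n : ℤ) * X ^ e * (PowerSeries.mk 1) ^ n + X ^ (2 * e) * R := by
  induction n with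
  | zero => exact ⟨0, by simp⟩
  | succ n ih =>
      obtain ⟨R, hR⟩ := ih
      refine ⟨C (n : ℤ) * (PowerSeries.mk 1) ^ (n + 1) + R * (PowerSeries.mk 1 - X ^ e * PowerSeries.mk 1), ?_⟩
      rw [pow_succ, hR]
      push_cast
      rw [map_add, map_one]
      ring

/-- THE COUNT: `h_{m+1}(d) = C(m+d, d) - (m+1)²` for `d ≥ 3`, i.e. the number of monomials of degree `d` in `m+1` variables with all
exponents `≤ d-2` (all `C(m+d, d)` monomials except the `(m+1)m` of shape `y_i^{d-1}y_j` and the `m+1` of shape `y_i^d`). -/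
theorem coeff_geom_trunc_pow (d m : ℕ) (hd : 3 ≤ d) :
    coeff d ((∑ j ∈ Finset.range (d - 1), (X : ℤ⟦X⟧) ^ j) ^ (m + 1)) = (Nat.choose (m + d) d : ℤ) - (m + 1) ^ 2 := by
  rw [geom_trunc_eq]
  obtain ⟨R, hR⟩ := pow_expand (d - 1) (m + 1)
  rw [hR, map_add, map_sub, mul_assoc, coeff_C_mul, coeff_X_pow_mul', coeff_X_pow_mul', mk_one_pow_eq_mk_choose_add,
    coeff_mk, if_pos (by omega), if_neg (by omega), coeff_mk, Nat.choose_symm_add]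
  have h1 : d - (d - 1) = 1 := by omega
  rw [h1, show m + 1 = m.succ from rfl, Nat.choose_succ_self_right]
  push_cast
  ring

/-- The two instances entering `c_d = 2h_k(d) - h_{m+1}(d) = c_N`: for `k = 3, d = 4` (`h = C(6,4) - 9 = 6`… as a coefficient) and a
larger sanity value `k = 7, d = 4`: `C(10,4) - 49 = 161` (the rank α of every k = 7 quartic row of the census). -/
theorem coeff_geom_trunc_pow_examples :
    coeff 4 ((∑ j ∈ Finset.range 3, (X : ℤ⟦X⟧) ^ j) ^ 3) = 6 ∧ coeff 4 ((∑ j ∈ Finset.range 3, (X : ℤ⟦X⟧) ^ j) ^ 7) = 161 := by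
  refine ⟨?_, ?_⟩
  · have := coeff_geom_trunc_pow 4 2 (by norm_num)
    norm_num [Nat.choose] at this
    simpa using this
  · have := coeff_geom_trunc_pow 4 6 (by norm_num)
    norm_num [Nat.choose] at this
    simpa using this

end Summit.HodgeConjecture.HodgeConjecture.HodgeLocus.Census.HilbertCount
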